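import Summits.Parity.GeneralizedHardyLittlewood.Theorems.PrimeLevelFamEdgeMomentsBeyondDiagonalDiagShapeOfSeries
import Summits.Parity.GeneralizedHardyLittlewood.Theorems.PrimeLevelFamEdgeMomentsBeyondDiagonalDiagProfileOne
import HarnessLib

/-!
# Route `PrimeLevelFamEdge`, crux K_A `MomentsBeyondDiagonal` (stmt-Parity-20007), line «petersson_layers» v4, stub `stub_diag`:
# **the order-`(0,0)` target of the general-`Q` assembly is DISCHARGED** (`τ₀₀ = secondMomentForm Δ' P 1 / 2`)

In the per-order reduction of `SubDiag` (`…DiagOrderAssembly.hasShape_diagPart_of_orderAsymptotics`: one `Q`-free target per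
order `(i,j)` with `i+j` even) the order `(0,0)` target is the `Q = 1` theorem of the tree: at `Q = 1` the explicit line series
of `…DiagLineSeries` is `1·1·ℓ⁰·(1+(−1)⁰)·q̂·S₀₀ = 2 q̂ S₀₀`, `‖diagPart q P 1 Δ' − line series‖ = O(1)`
(`…DiagBoxTailFinal.norm_diagPart_sub_lineSeries_le_const`) and `diagPart q P 1 Δ' = 2ζ(2)² q̂/(Δ'²ℓ²)·secondMomentForm Δ' P 1
+ O(q̂ℓ⁻³)` (`…DiagProfileOne.diagPart_profile_one_asymp`), whence
`ℓ⁰ q̂ S₀₀ = 2ζ(2)² q̂/(Δ'²ℓ²)·(secondMomentForm Δ' P 1 / 2) + O(q̂ℓ⁻³)`.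

* `half_asymp_aux` — the triangle-inequality bookkeeping;
* `lineSeries_order_zero_asymp` — **the order-`(0,0)` target, stated LITERALLY as the instance `i = j = 0` of the hypothesis of
  `hasShape_diagPart_of_orderAsymptotics`** (exponents `0 + 0` and `^ 0` kept unreduced so that it can be `exact`ed there).

Def-free; helper `--supports stmt-Parity-20007`; closes nothing; K_A, K_B and the Parity summit are NOT proved; nothing about
Landau–Siegel zeros.

## References
* E. Kowalski, P. Michel, J. VanderKam, J. reine angew. Math. 526 (2000), Prop. 5.1 (31) p. 18, (23)–(28) pp. 13–15.
  [cite: KowalskiMichelVanderKam2000, Prop. 5.1 (31) p. 18 — derivation (Q = 1, general admissible P)]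
-/

noncomputable section

open scoped Real
open Complex MeasureTheory Polynomial
open Literature.NumberTheory.LFunctions

namespace Summit.Parity.GeneralizedHardyLittlewood.Theorems.MomentsBeyondDiagonal.DiagLines

open Summit.Parity.GeneralizedHardyLittlewood.Theorems.PrimeLevelFamEdgeIdeaDeltas.PeterssonLayers
  (diagPart HasShape SubOf SubDiag)

/-- Triangle-inequality bookkeeping: from `‖d − 1·1·X·(1+(−1)^{0+0})·W·Z‖ ≤ C₁` and `‖d − M·μ‖ ≤ B` one gets
`‖X·W·Z − M·(μ/2)‖ ≤ (C₁ + B)/2`. [folklore] -/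
theorem half_asymp_aux {d X W Z M : ℂ} {μ C₁ B : ℝ}
    (hA : ‖d - 1 * 1 * X * (1 + (-1 : ℂ) ^ (0 + 0)) * W * Z‖ ≤ C₁) (hB : ‖d - M * ((μ : ℝ) : ℂ)‖ ≤ B) :
    ‖X * W * Z - M * (((μ / 2 : ℝ)) : ℂ)‖ ≤ (C₁ + B) / 2 := by
  have hE : (1 + (-1 : ℂ) ^ (0 + 0)) = 2 := by norm_num
  rw [hE] at hA
  have key : X * W * Z - M * (((μ / 2 : ℝ)) : ℂ) =
      ((1 / 2 : ℝ) : ℂ) * ((1 * 1 * X * 2 * W * Z - d) + (d - M * ((μ : ℝ) : ℂ))) := by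
    push_cast
    ring
  rw [key, norm_mul, Complex.norm_real, Real.norm_eq_abs, abs_of_pos (by norm_num : (0 : ℝ) < 1 / 2)]
  have hS : ‖1 * 1 * X * 2 * W * Z - d + (d - M * ((μ : ℝ) : ℂ))‖ ≤ C₁ + B := by
    refine (norm_add_le _ _).trans (add_le_add ?_ hB)
    rw [norm_sub_rev]
    exact hA
  exact (mul_le_mul_of_nonneg_left hS (by norm_num)).trans_eq (by ring)

/-- **THE ORDER-`(0,0)` TARGET OF THE GENERAL-`Q` ASSEMBLY, DISCHARGED.** For `KMV2000.Admissible P` and `Δ' ∈ (1, 3/2]`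
there are `C, q₀` with, for every level `q ≥ q₀` (`M = q̂^{Δ'}`, `ℓ = log q̂`; notation of `…DiagLineSeries`),
`‖ℓ^{−(0+0)} q̂ Σ_{m₁,m₂ ≤ M} x_{m₁}x_{m₂} Σ_{d₁∣m₁,d₂∣m₂} c (m₁m₂)^{−1/2} 𝔚₀₀(A₁,A₂;K/q̂²) − 2ζ(2)² q̂/(Δ'²ℓ²)·(secondMomentForm Δ' P 1 / 2)‖
≤ C q̂ ℓ⁻³` — literally the instance `i = j = 0`, `τ₀₀(Δ',P) = secondMomentForm Δ' P 1 / 2`, of the hypothesis of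
`…DiagOrderAssembly.hasShape_diagPart_of_orderAsymptotics`.
[cite: KowalskiMichelVanderKam2000, Prop. 5.1 (31) p. 18 — derivation (Q = 1, general admissible P)] -/
theorem lineSeries_order_zero_asymp {P : ℝ[X]} (hP : KMV2000.Admissible P) {Δ' : ℝ} (h1 : 1 < Δ') (h32 : Δ' ≤ 3 / 2) :
    ∃ C : ℝ, ∃ q₀ : ℕ, ∀ (q : ℕ) [NeZero q], q₀ ≤ q →
      ‖(((Real.log (KMV2000.qhat q))⁻¹ : ℝ) : ℂ) ^ (0 + 0) * (KMV2000.qhat q : ℂ) *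
          ∑ m₁ ∈ Finset.Icc 1 ⌊KMV2000.qhat q ^ Δ'⌋₊, ∑ m₂ ∈ Finset.Icc 1 ⌊KMV2000.qhat q ^ Δ'⌋₊,
            (KMV2000.mollifierCoeff P (KMV2000.qhat q ^ Δ') m₁ : ℂ) *
              (KMV2000.mollifierCoeff P (KMV2000.qhat q ^ Δ') m₂ : ℂ) *
            ∑ d₁ ∈ m₁.divisors, ∑ d₂ ∈ m₂.divisors,
              (((((m₁ / d₁).gcd (m₂ / d₂) : ℝ) * ((m₁ : ℝ) * m₂) ^ (-(1 / 2 : ℝ)) *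
                (∫ u₁ in Set.Ioi (0 : ℝ),
                  (Real.log (KMV2000.qhat q / ((d₁ * (m₂ / d₂ / (m₁ / d₁).gcd (m₂ / d₂)) : ℕ) : ℝ)) + Real.log u₁) ^ 0 *
                  ∫ u₂ in Set.Ioi (((((m₁ / (m₁ / d₁).gcd (m₂ / d₂)) * (m₂ / (m₁ / d₁).gcd (m₂ / d₂)) : ℕ) : ℝ) /
                      KMV2000.qhat q ^ 2) / u₁),
                    Real.exp (-(u₁ + u₂)) / (1 - Real.exp (-(u₁ + u₂))) ^ 2 *
                    (Real.log (KMV2000.qhat q / ((d₂ * (m₁ / d₁ / (m₁ / d₁).gcd (m₂ / d₂)) : ℕ) : ℝ)) + Real.log u₂) ^ 0)) : ℝ) : ℂ) -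
          ((2 * riemannZeta 2 ^ 2 *
              ((KMV2000.qhat q / (Δ' ^ 2 * Real.log (KMV2000.qhat q) ^ 2) : ℝ) : ℂ)) *
            ((KMV2000.secondMomentForm Δ' P 1 / 2 : ℝ) : ℂ))‖ ≤
        C * KMV2000.qhat q * (Real.log (KMV2000.qhat q))⁻¹ ^ 3 := by
  obtain ⟨C₁, hC₁⟩ := norm_diagPart_sub_lineSeries_le_const P (1 : ℝ[X]) (by linarith : (0 : ℝ) < Δ') h32
  obtain ⟨C₂, q₂, hC₂⟩ := diagPart_profile_one_asymp hP h1 h32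
  refine ⟨(27 * max C₁ 0 + C₂) / 2, max q₂ 400, fun q _ hq ↦ ?_⟩
  have hq₂ : q₂ ≤ q := (le_max_left _ _).trans hq
  have hq400 : 400 ≤ q := (le_max_right _ _).trans hq
  have hQ3 : 3 ≤ KMV2000.qhat q := FirstOrderAFE.three_le_qhat hq400
  have hQ1 : 1 ≤ KMV2000.qhat q := by linarith
  have hℓ0 : 0 < Real.log (KMV2000.qhat q) := Real.log_pos (by linarith)
  have hA := hC₁ q hq400
  have hB := hC₂ q hq₂
  rw [Polynomial.natDegree_one, zero_add, Finset.sum_range_one, Finset.sum_range_one, Polynomial.coeff_one_zero,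
    Complex.ofReal_one] at hA
  refine (half_asymp_aux hA hB).trans ?_
  -- `(C₁ + C₂ q̂ ℓ⁻³)/2 ≤ ((27 max(C₁,0) + C₂)/2) q̂ ℓ⁻³`, as `ℓ³ ≤ 27 q̂`
  have hunit : (1 : ℝ) ≤ 27 * KMV2000.qhat q * (Real.log (KMV2000.qhat q))⁻¹ ^ 3 := by
    have hl := log_pow_three_le_mul hQ1
    rw [inv_pow, ← div_eq_mul_inv, le_div_iff₀ (pow_pos hℓ0 3)]
    linarith
  have hC₁' : C₁ ≤ 27 * max C₁ 0 * (KMV2000.qhat q * (Real.log (KMV2000.qhat q))⁻¹ ^ 3) := by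
    calc C₁ ≤ max C₁ 0 := le_max_left _ _
      _ = max C₁ 0 * 1 := (mul_one _).symm
      _ ≤ max C₁ 0 * (27 * KMV2000.qhat q * (Real.log (KMV2000.qhat q))⁻¹ ^ 3) :=
          mul_le_mul_of_nonneg_left hunit (le_max_right _ _)
      _ = _ := by ring
  calc (C₁ + C₂ * KMV2000.qhat q * (Real.log (KMV2000.qhat q))⁻¹ ^ 3) / 2
      ≤ (27 * max C₁ 0 * (KMV2000.qhat q * (Real.log (KMV2000.qhat q))⁻¹ ^ 3) +
          C₂ * KMV2000.qhat q * (Real.log (KMV2000.qhat q))⁻¹ ^ 3) / 2 := by linarith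
    _ = (27 * max C₁ 0 + C₂) / 2 * KMV2000.qhat q * (Real.log (KMV2000.qhat q))⁻¹ ^ 3 := by ring

end Summit.Parity.GeneralizedHardyLittlewood.Theorems.MomentsBeyondDiagonal.DiagLines

end
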